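import Summits.QuantumFields.QCD.Theses.HeatSlicedQuarks
import Literature.Probability.LatticeModels.TorusFourierProofs

/-!
# Stub `stub_freeResolventFourier` of line `Sketch` (idea `drop-the-wilson-square`)
(crux `Summit.QuantumFields.QCD.Theses.HeatSlicedQuarks.ActionBoundsLowModes`,
item stmt-QuantumFields-8872, route route-QuantumFields-HeatSlicedQuarks)

We evaluate the diagonal of the fourth power of the free resolvent `(T₀ + ε)⁻¹` of the
double-step Laplacian `(T₀ f)(x) = Σ_μ (2 f(x) − f(x + 2μ̂) − f(x − 2μ̂))` on the discrete
torus `(ℤ/Lℤ)⁴`, by Fourier analysis: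

* (generic spectral kernel, `mul_kernel_eq_one`, `inv_pow_apply_of_eigen`) if a complex matrix `T`
  has eigenvectors `χ_i` (`T χ_i = λ_i χ_i`, `λ_i ≠ 0`) which resolve the identity,
  `Σ_i χ_i(y) conj χ_i(z) = c δ_{yz}` (`c ≠ 0`), then `T` is invertible with
  `T⁻¹ = c⁻¹ Σ_i λ_i⁻¹ χ_i conj χ_iᵀ`, `T⁻¹ χ_i = λ_i⁻¹ χ_i`, and expanding `δ_z`
  gives `(T⁻¹)^m (y,z) = c⁻¹ Σ_i λ_i^{-m} χ_i(y) conj χ_i(z)`;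
* (torus input) the characters `χ_k(x) = torusChar k x` of `(ℤ/L)⁴` resolve the identity with
  `c = L⁴` (`sum_torusChar_left`), and they diagonalise the (complexified) stencil
  (`stencil_mulVec_apply`, `eigen_of_stencil`): `χ_k(y ± 2μ̂) = χ_k(y) χ_k(±2μ̂)` and
  `2 − χ_k(2μ̂) − conj χ_k(2μ̂) = 2 − 2 cos(2θ) = 4 sin² θ`, `θ = 2π k_μ / L`
  (`torusChar_unitVec_eq`, via Mathlib's `ZMod.toCircle_apply`), so
  `(T₀ + ε) χ_k = (Σ_μ 4 sin²(2πk_μ/L) + ε) χ_k` with a strictly positive eigenvalue;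
* (real ↔ complex) the real matrix `T₀ + ε` is mapped entrywise into `ℂ` by the ring hom
  `Complex.ofRealHom`; invertibility over `ℂ` gives `det ≠ 0` over `ℝ` (`RingHom.map_det`),
  hence `((T₀+ε)⁻¹).map = ((T₀+ε).map)⁻¹` (`Matrix.inv_eq_right_inv`) and the same for
  fourth powers (`Matrix.map_pow`).

Taking `y = z = x` and `|χ_k(x)| = 1` yields the EQUALITY
`((T₀ + ε)⁻¹)⁴(x,x) = L⁻⁴ Σ_k (Σ_μ 4 sin²(2π k_μ/L) + ε)⁻⁴`;
the registered statement is `≤`.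
References: Friedli–Velenik 2017 §10.4 (torus Fourier analysis); the computation is folklore.
-/

namespace Summit.QuantumFields.QCD.Cruxes.ActionBoundsLowModes.DropTheWilsonSquare

open Literature.MathematicalPhysics Literature.MathematicalPhysics.QuantumLattice
  Literature.MathematicalPhysics.QuantumFieldTheory Literature.Probability.LatticeModels
open Matrix
open scoped Kronecker ComplexOrder ComplexConjugate

/-! ### A generic spectral kernel for inverse powers -/

/-- **Right inverse from a resolving eigenbasis.** If `T χ_i = λ_i χ_i` with `λ_i ≠ 0` and
`Σ_i χ_i(y) conj χ_i(z) = c δ_{yz}` with `c ≠ 0`, then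
`K(y,z) = c⁻¹ Σ_i λ_i⁻¹ χ_i(y) conj χ_i(z)` is a right inverse of `T`. -/
private theorem mul_kernel_eq_one {n ι : Type*} [Fintype n] [DecidableEq n] [Fintype ι]
    (T : Matrix n n ℂ) (χ : ι → n → ℂ) (lam : ι → ℂ) (c : ℂ) (hc : c ≠ 0)
    (hlam : ∀ i, lam i ≠ 0) (heig : ∀ i, T *ᵥ χ i = lam i • χ i)
    (horth : ∀ y z, ∑ i, χ i y * conj (χ i z) = if y = z then c else 0) :
    T * Matrix.of (fun y z => c⁻¹ * ∑ i, (lam i)⁻¹ * (χ i y * conj (χ i z))) = 1 := by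
  ext y z
  have hrow : ∀ i, ∑ w, T y w * χ i w = lam i * χ i y := fun i => by
    have h := congrFun (heig i) y
    simpa only [Matrix.mulVec, dotProduct, Pi.smul_apply, smul_eq_mul] using h
  rw [Matrix.mul_apply, Matrix.one_apply]
  simp only [Matrix.of_apply]
  calc ∑ w, T y w * (c⁻¹ * ∑ i, (lam i)⁻¹ * (χ i w * conj (χ i z)))
      = ∑ w, ∑ i, c⁻¹ * ((lam i)⁻¹ * conj (χ i z)) * (T y w * χ i w) := by
        refine Finset.sum_congr rfl fun w _ => ?_
        rw [Finset.mul_sum, Finset.mul_sum]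
        refine Finset.sum_congr rfl fun i _ => ?_
        ring
    _ = ∑ i, c⁻¹ * ((lam i)⁻¹ * conj (χ i z)) * (lam i * χ i y) := by
        rw [Finset.sum_comm]
        refine Finset.sum_congr rfl fun i _ => ?_
        rw [← Finset.mul_sum, hrow i]
    _ = c⁻¹ * ∑ i, χ i y * conj (χ i z) := by
        rw [Finset.mul_sum]
        refine Finset.sum_congr rfl fun i _ => ?_
        rw [show c⁻¹ * ((lam i)⁻¹ * conj (χ i z)) * (lam i * χ i y) =
            ((lam i)⁻¹ * lam i) * (c⁻¹ * (χ i y * conj (χ i z))) by ring,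
          inv_mul_cancel₀ (hlam i), one_mul]
    _ = if y = z then 1 else 0 := by
        rw [horth]
        split_ifs
        · exact inv_mul_cancel₀ hc
        · exact mul_zero _

/-- **Spectral kernel of inverse powers.** Under the hypotheses of `mul_kernel_eq_one`,
`(T⁻¹)^m (y,z) = c⁻¹ Σ_i λ_i^{-m} χ_i(y) conj χ_i(z)` for every `m`. -/
private theorem inv_pow_apply_of_eigen {n ι : Type*} [Fintype n] [DecidableEq n] [Fintype ι]
    (T : Matrix n n ℂ) (χ : ι → n → ℂ) (lam : ι → ℂ) (c : ℂ) (hc : c ≠ 0)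
    (hlam : ∀ i, lam i ≠ 0) (heig : ∀ i, T *ᵥ χ i = lam i • χ i)
    (horth : ∀ y z, ∑ i, χ i y * conj (χ i z) = if y = z then c else 0) (m : ℕ) (y z : n) :
    (T⁻¹ ^ m) y z = c⁻¹ * ∑ i, (lam i)⁻¹ ^ m * (χ i y * conj (χ i z)) := by
  have hK := mul_kernel_eq_one T χ lam c hc hlam heig horth
  have hinvT : T⁻¹ * T = 1 := Matrix.nonsing_inv_mul T (Matrix.isUnit_det_of_right_inverse hK)
  have heig' : ∀ i, T⁻¹ *ᵥ χ i = (lam i)⁻¹ • χ i := fun i => by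
    have h1 : T⁻¹ *ᵥ (T *ᵥ χ i) = χ i := by
      rw [Matrix.mulVec_mulVec, hinvT, Matrix.one_mulVec]
    rw [heig i, Matrix.mulVec_smul] at h1
    calc T⁻¹ *ᵥ χ i = (lam i)⁻¹ • (lam i • (T⁻¹ *ᵥ χ i)) := by
          rw [smul_smul, inv_mul_cancel₀ (hlam i), one_smul]
      _ = (lam i)⁻¹ • χ i := by rw [h1]
  have hpow : ∀ (j : ℕ) (i : ι), (T⁻¹ ^ j) *ᵥ χ i = ((lam i)⁻¹ ^ j) • χ i := by
    intro j i
    induction j with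
    | zero => rw [pow_zero, pow_zero, Matrix.one_mulVec, one_smul]
    | succ j ih =>
        rw [pow_succ' (lam i)⁻¹ j, pow_succ T⁻¹ j, ← Matrix.mulVec_mulVec, heig',
          Matrix.mulVec_smul, ih, smul_smul]
  have hdelta : (Pi.single z (1 : ℂ) : n → ℂ) = ∑ i, (c⁻¹ * conj (χ i z)) • χ i := by
    funext w
    rw [Finset.sum_apply]
    simp only [Pi.smul_apply, smul_eq_mul]
    have h2 : ∑ i, c⁻¹ * conj (χ i z) * χ i w = c⁻¹ * ∑ i, χ i w * conj (χ i z) := by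
      rw [Finset.mul_sum]
      refine Finset.sum_congr rfl fun i _ => ?_
      ring
    rw [h2, horth, Pi.single_apply]
    split_ifs
    · exact (inv_mul_cancel₀ hc).symm
    · exact (mul_zero _).symm
  calc (T⁻¹ ^ m) y z = ((T⁻¹ ^ m) *ᵥ (Pi.single z 1)) y := by
        rw [Matrix.mulVec_single_one, Matrix.col_apply]
    _ = ((T⁻¹ ^ m) *ᵥ (∑ i, (c⁻¹ * conj (χ i z)) • χ i)) y := by rw [hdelta]
    _ = (∑ i, (c⁻¹ * conj (χ i z)) • (((lam i)⁻¹ ^ m) • χ i)) y := by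
        rw [Matrix.mulVec_sum]
        simp_rw [Matrix.mulVec_smul, hpow]
    _ = c⁻¹ * ∑ i, (lam i)⁻¹ ^ m * (χ i y * conj (χ i z)) := by
        rw [Finset.sum_apply, Finset.mul_sum]
        refine Finset.sum_congr rfl fun i _ => ?_
        simp only [Pi.smul_apply, smul_eq_mul]
        ring

/-! ### Torus input: characters resolve the identity and diagonalise the stencil -/

/-- Completeness of the characters of `(ℤ/L)^d`: `Σ_k χ_k(y) conj χ_k(z) = L^d δ_{yz}`. -/
private theorem sum_torusChar_mul_conj_eq {d L : ℕ} [NeZero L] (y z : TorusSite d L) :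
    ∑ k : TorusSite d L, torusChar k y * conj (torusChar k z) =
      if y = z then (L : ℂ) ^ d else 0 := by
  simp_rw [← torusChar_sub_right]
  rw [sum_torusChar_left]
  simp only [sub_eq_zero]

/-- The character at a unit vector: `χ_k(e_μ) = cos θ + i sin θ`, `θ = 2π k_μ.val / L`
(the `d`-fold product collapses to Mathlib's `ZMod.stdAddChar (k μ) = ZMod.toCircle (k μ)`). -/
private theorem torusChar_unitVec_eq {d L : ℕ} [NeZero L] (k : TorusSite d L) (μ : Fin d) :
    torusChar k (Pi.single μ 1) =
      ⟨Real.cos (2 * Real.pi * ((k μ).val : ℝ) / L),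
        Real.sin (2 * Real.pi * ((k μ).val : ℝ) / L)⟩ := by
  classical
  have h1 : torusChar k (Pi.single μ 1) = ZMod.stdAddChar (k μ) := by
    unfold torusChar
    rw [Finset.prod_eq_single μ]
    · simp
    · intro i _ hi
      simp [Pi.single_eq_of_ne hi]
    · simp
  have h2 : torusChar k (Pi.single μ 1) =
      Complex.exp ((2 * Real.pi * ((k μ).val : ℝ) / L : ℝ) * Complex.I) := by
    rw [h1, ZMod.stdAddChar_apply, ZMod.toCircle_apply]
    congr 1
    push_cast
    ring
  rw [h2]
  exact Complex.ext (Complex.exp_ofReal_mul_I_re _) (Complex.exp_ofReal_mul_I_im _)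

/-- The symbol of one direction of the double-step stencil:
`2 − χ_k(2 e_μ) − conj χ_k(2 e_μ) = 4 sin²(2π k_μ / L)`. -/
private theorem two_sub_torusChar_two_nsmul_single {d L : ℕ} [NeZero L] (k : TorusSite d L)
    (μ : Fin d) :
    (2 : ℂ) - torusChar k (2 • Pi.single μ 1) - conj (torusChar k (2 • Pi.single μ 1)) =
      ((4 * Real.sin (2 * Real.pi * ((k μ).val : ℝ) / (L : ℝ)) ^ 2 : ℝ) : ℂ) := by
  have hw := torusChar_unitVec_eq k μ
  have hsc := Real.sin_sq_add_cos_sq (2 * Real.pi * ((k μ).val : ℝ) / L)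
  rw [two_nsmul, torusChar_add_right, hw]
  apply Complex.ext
  · rw [Complex.ofReal_re]
    simp only [Complex.sub_re, Complex.mul_re, Complex.conj_re, Complex.re_ofNat]
    linear_combination (-2 : ℝ) * hsc
  · rw [Complex.ofReal_im]
    simp only [Complex.sub_im, Complex.mul_im, Complex.conj_im, Complex.im_ofNat]
    ring

/-- The complexified stencil acting on a vector: if `H = T₀ + ε` (real), then
`((H v)(y) = Σ_μ (2 v(y) − v(y + 2μ̂) − v(y − 2μ̂)) + ε v(y)` for complex `v`. -/
private theorem stencil_mulVec_apply {L : ℕ} [NeZero L] (ε : ℝ)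
    (H : Matrix (TorusSite 4 L) (TorusSite 4 L) ℝ)
    (hH : H = Matrix.of (fun x y : TorusSite 4 L => ∑ μ : Fin 4,
            ((if y = x then (2 : ℝ) else 0) - (if y = x + 2 • Pi.single μ 1 then 1 else 0) -
              (if y = x - 2 • Pi.single μ 1 then 1 else 0))) +
          ε • (1 : Matrix (TorusSite 4 L) (TorusSite 4 L) ℝ))
    (v : TorusSite 4 L → ℂ) (y : TorusSite 4 L) :
    (H.map Complex.ofRealHom *ᵥ v) y =
      (∑ μ : Fin 4, (2 * v y - v (y + 2 • Pi.single μ 1) - v (y - 2 • Pi.single μ 1))) +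
        (ε : ℂ) * v y := by
  have hz : ∀ z, (H.map Complex.ofRealHom) y z * v z =
      (∑ μ : Fin 4, ((if z = y then 2 * v z else 0) -
        (if z = y + 2 • Pi.single μ 1 then v z else 0) -
        (if z = y - 2 • Pi.single μ 1 then v z else 0))) +
        (if z = y then (ε : ℂ) * v z else 0) := by
    intro z
    rw [hH]
    simp only [Matrix.map_apply, Matrix.add_apply, Matrix.of_apply, Matrix.smul_apply,
      Matrix.one_apply, smul_eq_mul, Complex.ofRealHom_eq_coe, Complex.ofReal_add,
      Complex.ofReal_sum,
      Complex.ofReal_sub, Complex.ofReal_mul, apply_ite Complex.ofReal, Complex.ofReal_one,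
      Complex.ofReal_zero, Complex.ofReal_ofNat]
    rw [add_mul, Finset.sum_mul]
    congr 1
    · refine Finset.sum_congr rfl fun μ _ => ?_
      split_ifs <;> ring
    · by_cases h : z = y
      · subst h
        simp
      · simp [h, Ne.symm h]
  simp only [Matrix.mulVec, dotProduct]
  simp_rw [hz]
  rw [Finset.sum_add_distrib, Finset.sum_comm]
  simp only [Finset.sum_sub_distrib, Finset.sum_ite_eq', Finset.mem_univ, if_true]

/-- **Characters diagonalise the stencil**: if `Hc` acts by the double-step stencil plus `ε`,
then `Hc χ_k = (Σ_μ 4 sin²(2π k_μ/L) + ε) χ_k`. -/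
private theorem eigen_of_stencil {L : ℕ} [NeZero L] (ε : ℝ)
    (Hc : Matrix (TorusSite 4 L) (TorusSite 4 L) ℂ)
    (hHc : ∀ (v : TorusSite 4 L → ℂ) (y : TorusSite 4 L), (Hc *ᵥ v) y =
      (∑ μ : Fin 4, (2 * v y - v (y + 2 • Pi.single μ 1) - v (y - 2 • Pi.single μ 1))) +
        (ε : ℂ) * v y)
    (k : TorusSite 4 L) :
    Hc *ᵥ torusChar k =
      (((∑ μ : Fin 4, 4 * Real.sin (2 * Real.pi * ((k μ).val : ℝ) / L) ^ 2) + ε : ℝ) :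
          ℂ) • torusChar k := by
  funext y
  rw [hHc]
  simp only [Pi.smul_apply, smul_eq_mul]
  simp_rw [torusChar_add_right, torusChar_sub_right]
  have hμ : ∀ μ : Fin 4,
      2 * torusChar k y - torusChar k y * torusChar k (2 • Pi.single μ 1) -
        torusChar k y * conj (torusChar k (2 • Pi.single μ 1)) =
      torusChar k y *
        ((4 * Real.sin (2 * Real.pi * ((k μ).val : ℝ) / (L : ℝ)) ^ 2 : ℝ) : ℂ) :=
    fun μ => by
      rw [← two_sub_torusChar_two_nsmul_single k μ]
      ring
  simp_rw [hμ]
  rw [← Finset.mul_sum, Complex.ofReal_add, Complex.ofReal_sum]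
  ring

/-- **Stub C2b (`stub_freeResolventFourier`, torus Fourier diagonalisation of the free resolvent power).**
For `ε > 0`: `((T₀ + ε)⁻¹)⁴(x,x) ≤ L⁻⁴ Σ_{k ∈ (ℤ/L)⁴} (Σ_μ 4 sin²(2π k_μ/L) + ε)⁻⁴` (in fact equality):
the characters `χ_k(x) = torusChar k x` diagonalise the translation-invariant `T₀` with symbol
`Σ_μ (2 − 2cos(4π k_μ/L)) = Σ_μ 4 sin²(2π k_μ/L)`; expand `δ_x` by Fourier inversion
(`torusFourier_inversion_holds`), `|χ_k(x)| = 1`. -/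
theorem stub_freeResolventFourier :
    ∀ (L : ℕ) [NeZero L] (ε : ℝ), 0 < ε → ∀ (x : TorusSite 4 L),
      ((Matrix.of (fun x y : TorusSite 4 L => ∑ μ : Fin 4,
            ((if y = x then (2 : ℝ) else 0) - (if y = x + 2 • Pi.single μ 1 then 1 else 0) -
              (if y = x - 2 • Pi.single μ 1 then 1 else 0))) +
          ε • (1 : Matrix (TorusSite 4 L) (TorusSite 4 L) ℝ))⁻¹ ^ 4) x x ≤
        (1 / (L : ℝ) ^ 4) * ∑ k : TorusSite 4 L,
          1 / (∑ μ : Fin 4, 4 * Real.sin (2 * Real.pi * ((k μ).val : ℝ) / L) ^ 2 + ε) ^ 4 := by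
  intro L _ ε hε x
  apply le_of_eq
  set H : Matrix (TorusSite 4 L) (TorusSite 4 L) ℝ :=
    Matrix.of (fun x y : TorusSite 4 L => ∑ μ : Fin 4,
        ((if y = x then (2 : ℝ) else 0) - (if y = x + 2 • Pi.single μ 1 then 1 else 0) -
          (if y = x - 2 • Pi.single μ 1 then 1 else 0))) +
      ε • (1 : Matrix (TorusSite 4 L) (TorusSite 4 L) ℝ) with hHdef
  have hL : (L : ℂ) ^ 4 ≠ 0 := natCast_pow_ne_zero
  have hlam : ∀ k : TorusSite 4 L,
      (((∑ μ : Fin 4, 4 * Real.sin (2 * Real.pi * ((k μ).val : ℝ) / L) ^ 2) + ε : ℝ) :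
        ℂ) ≠ 0 :=
    fun k => Complex.ofReal_ne_zero.mpr
      (add_pos_of_nonneg_of_pos (Finset.sum_nonneg fun μ _ => by positivity) hε).ne'
  -- the complexified matrix and the generic spectral lemmas
  have hstencil := stencil_mulVec_apply ε H hHdef
  have heig := eigen_of_stencil ε (H.map Complex.ofRealHom) hstencil
  have hK := mul_kernel_eq_one (H.map Complex.ofRealHom) torusChar _ ((L : ℂ) ^ 4) hL hlam heig
    sum_torusChar_mul_conj_eq
  have hmain := inv_pow_apply_of_eigen (H.map Complex.ofRealHom) torusChar _ ((L : ℂ) ^ 4) hL hlam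
    heig sum_torusChar_mul_conj_eq 4 x x
  -- invertibility of the real matrix, and transfer of the inverse along `ℝ → ℂ`
  have hdet : IsUnit H.det := by
    have h1 : IsUnit ((H.map Complex.ofRealHom).det) := Matrix.isUnit_det_of_right_inverse hK
    rw [← RingHom.mapMatrix_apply, ← RingHom.map_det] at h1
    rw [isUnit_iff_ne_zero] at h1 ⊢
    intro h0
    apply h1
    rw [h0, map_zero]
  have hinvC : H.map Complex.ofRealHom * (H⁻¹).map Complex.ofRealHom = 1 := by
    rw [← Matrix.map_mul, Matrix.mul_nonsing_inv _ hdet,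
      Matrix.map_one _ (map_zero _) (map_one _)]
  have hinv : (H.map Complex.ofRealHom)⁻¹ = (H⁻¹).map Complex.ofRealHom :=
    Matrix.inv_eq_right_inv hinvC
  have hentry : (((H⁻¹ ^ 4) x x : ℝ) : ℂ) = ((H.map Complex.ofRealHom)⁻¹ ^ 4) x x := by
    rw [hinv, ← Matrix.map_pow, Matrix.map_apply, Complex.ofRealHom_eq_coe]
  apply Complex.ofReal_injective
  rw [hentry, hmain]
  simp_rw [torusChar_mul_conj, mul_one]
  rw [Complex.ofReal_mul, Complex.ofReal_sum]
  congr 1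
  · push_cast
    rw [one_div]
  · refine Finset.sum_congr rfl fun k _ => ?_
    rw [Complex.ofReal_div, Complex.ofReal_one, Complex.ofReal_pow, one_div, inv_pow]

end Summit.QuantumFields.QCD.Cruxes.ActionBoundsLowModes.DropTheWilsonSquare
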